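import Mathlib
import HarnessLib
import Literature.Probability.Percolation.CornerPercolation
import Literature.Probability.Percolation.ProdBernoulliRusso
import Literature.Probability.Percolation.HalfPlaneUCatch
import Literature.Probability.LatticeModels.DomainDiscretisation
import Literature.Barriers.CriticalPhenomena.EmbeddingModulusUniqueness
import Summits.CriticalPhenomena.CardyFormulaZ2.Theorems.CardySelfDualSegmentSegmentOpenStubCrossingProbPolynomial

/-!
# Crux `SegmentOpen` (stmt-CriticalPhenomena-5471), line `Sketch`:
# stub `stub_uniformComplexBound_of_smallMesh`

Worker file. The theorem name, namespace, `open` lines and the statement text are EXACTLY those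
registered by the lead's skeleton (`work/SegmentOpen.lean`, `Cruxes/SegmentOpen/Lines/Sketch.lean`);
do not change them. Helper lemmas live in the sub-namespace `UniformComplexBoundLargeMesh`, above
the theorem, each with a docstring.

S4g of the line (LARGE MESH IS HARMLESS): the small-mesh uniform complex bound S4s (the bound on
the disc `B(t₀, r)` for the crossing polynomials of `R` at meshes `δ < δ₁(R)`) upgrades to all
meshes `δ > 0` with the same radius `r`. Proof: the carrier of `R` lies in a closed ball
`B̄(0, M)`, so a vertex `y` of `ℤ²` drawn at a mesh `δ ≥ δ₁` (`δ √2 (y₀ + i y₁) ∈ R.carrier`) is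
drawn at mesh `δ₁` inside `B̄(0, M)`: all of them lie in ONE finite set `U` (`meshVertices_finite`).
The coin-space crossing event is then a cylinder event over the fixed coordinate set `U × {0, 1}`
(locality of open crossings, `HalfPlaneArm.determinedBy_openCrossing_of_finite`, read through
`mem_cornerConfig_iff`), so `RussoPath.prodBernoulli_real_eq_sum_powerset` writes `P_t(R, δ)` as
the cylinder polynomial `Σ_{T ⊆ U × {0,1}, T ∈ event} ∏_i (w_i if i ∈ T else 1 - w_i)` with
`w_{(v, j)} = (1/2) X^j` (exactly S1's formula, now over an index set independent of `δ ≥ δ₁`).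
Each complex weight has modulus `≤ 2 + |z|`, so the polynomial is bounded by
`(2 (2 + |z|))^{2 |U|} ≤ (2 (3 + r))^{2 |U|}` on `B(t₀, r)` (`|z| ≤ 1 + r` there); and the
polynomial `p` of the statement, which agrees with `P_·(R, δ)` on the infinite set `[0, 1]`, IS
that cylinder polynomial (`Polynomial.eq_of_infinite_eval_eq`). The bound `max C_small C_large`
serves all `δ > 0`.
-/

noncomputable section

namespace Summit.CriticalPhenomena.CardyFormulaZ2.Theorems

open Literature.Probability Literature.Barriers.CriticalPhenomena
open Literature.Probability.RandomPlanarGeometry (ConformalRectangle ConformalEquiv MarkedDomain)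
open Filter Set Topology

namespace UniformComplexBoundLargeMesh

open Literature.Probability.LatticeModels Literature.Probability.Percolation

/-- For `δ > 0` only finitely many vertices of `ℤ²` are drawn (on `√2 ℤ²`, at mesh `δ`) inside a
bounded set `Ω`: they are the mesh vertices of `Ω` at mesh `δ √2` (`meshVertices_finite`). -/
theorem finite_drawn {Ω : Set ℂ} (hΩ : Bornology.IsBounded Ω) {δ : ℝ} (hδ : 0 < δ) :
    {y : Site 2 | (δ : ℂ) * squareLatticeEmbedding.z y ∈ Ω}.Finite := by
  -- adapted from `finite_verts`
  -- (Theorems/CardySelfDualSegmentSegmentOpenStubCrossingProbPolynomial.lean)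
  have h : {y : Site 2 | (δ : ℂ) * squareLatticeEmbedding.z y ∈ Ω} =
      meshVertices Ω (δ * Real.sqrt 2) := by
    ext y
    simp only [Set.mem_setOf_eq, mem_meshVertices_iff, meshPoint]
    rw [show squareLatticeEmbedding.z y = (Real.sqrt 2 : ℂ) * Site.toComplex y from rfl,
      ← mul_assoc, Complex.ofReal_mul]
  rw [h]
  exact meshVertices_finite hΩ (mul_pos hδ (Real.sqrt_pos.2 two_pos))

/-- A vertex drawn at a mesh `δ ≥ δ₁ > 0` inside a set `Ω ⊆ B̄(0, M)` is drawn at mesh `δ₁`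
inside `B̄(0, M)` (`δ₁ |z y| ≤ δ |z y| ≤ M`). -/
theorem drawn_subset_of_le {Ω : Set ℂ} {M : ℝ} (hM : Ω ⊆ Metric.closedBall 0 M) {δ₁ δ : ℝ}
    (hδ₁ : 0 < δ₁) (hδ : δ₁ ≤ δ) :
    {y : Site 2 | (δ : ℂ) * squareLatticeEmbedding.z y ∈ Ω} ⊆
      {y : Site 2 | (δ₁ : ℂ) * squareLatticeEmbedding.z y ∈ Metric.closedBall (0 : ℂ) M} := by
  intro y hy
  have h := hM hy
  rw [Metric.mem_closedBall, dist_zero_right, norm_mul,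
    Complex.norm_of_nonneg (hδ₁.le.trans hδ)] at h
  rw [Set.mem_setOf_eq, Metric.mem_closedBall, dist_zero_right, norm_mul,
    Complex.norm_of_nonneg hδ₁.le]
  exact (mul_le_mul_of_nonneg_right hδ (norm_nonneg _)).trans h

/-- If the vertices drawn at mesh `δ` inside the carrier of `R` all lie in the finite set `U`,
the coin-space form `{S | cornerConfig S ∈ E}` of the crude crossing event `E` is a cylinder
event over the coins and splitting bits of `U`: `E` depends only on the edges with both endpoints
drawn in the carrier (`HalfPlaneArm.determinedBy_openCrossing_of_finite`), and the state of such
an edge `{v, v + e_j}` reads the two bits at `v` only (`mem_cornerConfig_iff`). -/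
theorem determinedBy_coinEvent_of_subset (R : ConformalRectangle) (δ : ℝ) {U : Finset (Site 2)}
    (hU : {y : Site 2 | (δ : ℂ) * squareLatticeEmbedding.z y ∈ R.carrier} ⊆ ↑U) :
    DeterminedBy
      {S : Set (Site 2 × Fin 2) | cornerConfig S ∈
        embDomainCrossing squareLatticeEmbedding.z R.carrier δ (R.arc 0) (R.arc 2)}
      ↑(U ×ˢ (Finset.univ : Finset (Fin 2))) := by
  -- adapted from `determinedBy_coinEvent`
  -- (Theorems/CardySelfDualSegmentSegmentOpenStubCrossingProbPolynomial.lean)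
  have hE := HalfPlaneArm.determinedBy_openCrossing_of_finite (U.finite_toSet.subset hU)
    {u | Metric.infDist ((δ : ℂ) * squareLatticeEmbedding.z u) (R.arc 0) ≤ 2 * δ}
    {v | Metric.infDist ((δ : ℂ) * squareLatticeEmbedding.z v) (R.arc 2) ≤ 2 * δ}
  rw [determinedBy_iff] at hE ⊢
  intro S S' hSS'
  -- the two coin sets agree on the bits of the vertices of `U`
  have hcoin : ∀ v ∈ U, ∀ j : Fin 2, ((v, j) ∈ S ↔ (v, j) ∈ S') := by
    intro v hv j
    have hmem : (v, j) ∈ (↑(U ×ˢ (Finset.univ : Finset (Fin 2))) : Set (Site 2 × Fin 2)) := by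
      rw [Finset.coe_product, Finset.coe_univ]
      exact ⟨hv, Set.mem_univ _⟩
    exact ⟨fun h => ((Set.ext_iff.1 hSS' (v, j)).1 ⟨h, hmem⟩).1,
      fun h => ((Set.ext_iff.1 hSS' (v, j)).2 ⟨h, hmem⟩).1⟩
  -- hence the two corner configurations agree on the edges joining two drawn vertices
  refine hE (cornerConfig S) (cornerConfig S') ?_
  ext e
  refine and_congr_left fun he => ?_
  rw [mem_cornerConfig_iff, mem_cornerConfig_iff]
  refine exists_congr fun v => or_congr (and_congr_right fun hev => ?_)
    (and_congr_right fun hev => ?_)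
  · exact hcoin v (hU (he v (hev ▸ Sym2.mem_mk_left _ _))) 0
  · have hv : v ∈ U := hU (he v (hev ▸ Sym2.mem_mk_left _ _))
    exact iff_congr (hcoin v hv 0) (not_congr (hcoin v hv 1))

/-- If the coin-space crossing event at mesh `δ` is a cylinder event over the finite coordinate
set `K`, the crude crossing probability `P_t(R, δ)` is a polynomial `q` in `t` bounded by
`(2 (2 + |z|))^{|K|}` at every `z ∈ ℂ`. Indeed `RussoPath.prodBernoulli_real_eq_sum_powerset`
(parameters `1/2` on coins, `t/2` on splitting bits) gives S1's cylinder polynomial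
`q = Σ_{T ⊆ K, T ∈ event} ∏_{i ∈ K} (w_i if i ∈ T else 1 - w_i)` with `w_{(v, j)} = (1/2) X^j`,
and on `ℂ` each weight `(1/2) z^j`, `1 - (1/2) z^j` (`j ∈ {0, 1}`) has modulus at most `2 + |z|`,
so `|q(z)| ≤ Σ_{T ⊆ K} (2 + |z|)^{|K|} = (2 (2 + |z|))^{|K|}`. -/
theorem exists_cylinderPolynomial (R : ConformalRectangle) (δ : ℝ) {K : Finset (Site 2 × Fin 2)}
    (hK : DeterminedBy
      {S : Set (Site 2 × Fin 2) | cornerConfig S ∈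
        embDomainCrossing squareLatticeEmbedding.z R.carrier δ (R.arc 0) (R.arc 2)} ↑K) :
    ∃ q : Polynomial ℝ, (∀ t : unitInterval, cornerCrossingProb t R δ = q.eval (t : ℝ)) ∧
      ∀ z : ℂ, ‖(q.map (algebraMap ℝ ℂ)).eval z‖ ≤ (2 * (2 + ‖z‖)) ^ K.card := by
  classical
  -- S1's cylinder polynomial over `K`
  refine ⟨∑ T ∈ K.powerset, if (↑T : Set (Site 2 × Fin 2)) ∈
      {S : Set (Site 2 × Fin 2) | cornerConfig S ∈
        embDomainCrossing squareLatticeEmbedding.z R.carrier δ (R.arc 0) (R.arc 2)} then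
      ∏ i ∈ K, (if i ∈ T then Polynomial.C (1 / 2 : ℝ) * Polynomial.X ^ (i.2 : ℕ)
        else 1 - Polynomial.C (1 / 2 : ℝ) * Polynomial.X ^ (i.2 : ℕ)) else 0,
    fun t => ?_, fun z => ?_⟩
  · -- adapted from the proof of `stub_crossingProbPolynomial`
    -- (Theorems/CardySelfDualSegmentSegmentOpenStubCrossingProbPolynomial.lean)
    -- the parameters as monomials in `t`: `p_{(v, j)} = (1/2) t^j`
    have hw : ∀ i : Site 2 × Fin 2,
        ((cornerParam t i : unitInterval) : ℝ) = 1 / 2 * (t : ℝ) ^ (i.2 : ℕ) := by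
      rintro ⟨v, j⟩
      fin_cases j <;> simp
    have h := RussoPath.prodBernoulli_real_eq_sum_powerset hK (cornerParam t)
    change (prodBernoulli (cornerParam t)).real _ = _
    rw [h, Polynomial.eval_finsetSum]
    refine Finset.sum_congr rfl fun T _ => ?_
    by_cases hT : (↑T : Set (Site 2 × Fin 2)) ∈ {S : Set (Site 2 × Fin 2) | cornerConfig S ∈
        embDomainCrossing squareLatticeEmbedding.z R.carrier δ (R.arc 0) (R.arc 2)}
    · simp only [if_pos hT, Polynomial.eval_prod]
      refine Finset.prod_congr rfl fun i _ => ?_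
      by_cases hi : i ∈ T
      · simp only [if_pos hi, Polynomial.eval_mul, Polynomial.eval_C, Polynomial.eval_pow,
          Polynomial.eval_X, hw]
      · simp only [if_neg hi, Polynomial.eval_sub, Polynomial.eval_one, Polynomial.eval_mul,
          Polynomial.eval_C, Polynomial.eval_pow, Polynomial.eval_X, hw]
    · simp only [if_neg hT, Polynomial.eval_zero]
  · rw [Polynomial.eval_map, ← Polynomial.aeval_def, map_sum]
    -- each weight has modulus at most `2 + |z|`
    have hw : ∀ (i : Site 2 × Fin 2) (T : Finset (Site 2 × Fin 2)),
        ‖Polynomial.aeval z (if i ∈ T then Polynomial.C (1 / 2 : ℝ) * Polynomial.X ^ (i.2 : ℕ)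
          else 1 - Polynomial.C (1 / 2 : ℝ) * Polynomial.X ^ (i.2 : ℕ))‖ ≤ 2 + ‖z‖ := by
      intro i T
      have hj : ‖z ^ (i.2 : ℕ)‖ ≤ 1 + ‖z‖ := by
        obtain ⟨v, j⟩ := i
        fin_cases j <;> simp
      have hc : ‖Polynomial.aeval z (Polynomial.C (1 / 2 : ℝ) * Polynomial.X ^ (i.2 : ℕ))‖
          ≤ 1 + ‖z‖ := by
        rw [map_mul, Polynomial.aeval_C, map_pow, Polynomial.aeval_X, norm_mul,
          Complex.coe_algebraMap, Complex.norm_of_nonneg (by norm_num : (0 : ℝ) ≤ 1 / 2)]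
        linarith [norm_nonneg (z ^ (i.2 : ℕ)), norm_nonneg z]
      split_ifs
      · linarith [norm_nonneg z]
      · rw [map_sub, map_one]
        refine (norm_sub_le _ _).trans ?_
        rw [norm_one]
        linarith
    refine (norm_sum_le _ _).trans ?_
    refine (Finset.sum_le_sum (g := fun _ => (2 + ‖z‖) ^ K.card) fun T _ => ?_).trans
      (le_of_eq ?_)
    · show _ ≤ (2 + ‖z‖) ^ K.card
      split_ifs
      · rw [map_prod, norm_prod]
        exact (Finset.prod_le_prod (fun i _ => norm_nonneg _) fun i _ => hw i T).trans
          (le_of_eq (Finset.prod_const _))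
      · rw [map_zero, norm_zero]
        positivity
    · rw [Finset.sum_const, Finset.card_powerset, nsmul_eq_mul, Nat.cast_pow, Nat.cast_ofNat,
        mul_pow]

end UniformComplexBoundLargeMesh

open UniformComplexBoundLargeMesh Literature.Probability.LatticeModels
  Literature.Probability.Percolation in
/-- S4g (glue; M). LARGE MESH IS HARMLESS: the small-mesh uniform bound S4s upgrades to the full
S4 (all `δ > 0`, same radius). For `δ ≥ δ₁(R)` only the finitely many vertices `y` with
`δ √2 · y ∈ R.carrier ⊆ B̄(0, M)` can be drawn, all in one finite set `U` uniformly in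
`δ ≥ δ₁`; the crude crossing event is a cylinder event over their coins and splitting bits, so
(`RussoPath.prodBernoulli_real_eq_sum_powerset`, as in S1) the crossing polynomial is
`Σ_{T} [T ∈ event] ∏_{i} w_i` with `w_i ∈ {1/2, X/2, 1 - X/2}`, whence
`|p(z)| ≤ (2 (2 + |z|))^{2|U|} ≤ (2 (3 + r))^{2|U|}` on the disc `B(t₀, r)` (the polynomial
agreeing with `P_·(R, δ)` on `[0,1]` is unique); the bound `max C_small C_large` serves all
`δ > 0`. -/
theorem stub_uniformComplexBound_of_smallMesh :
    (∀ t₀ : unitInterval, ∃ r > 0, ∀ R : ConformalRectangle, ∃ δ₁ > 0, ∃ C : ℝ, ∀ δ : ℝ,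
      0 < δ → δ < δ₁ → ∀ p : Polynomial ℝ,
        (∀ t : unitInterval, Percolation.cornerCrossingProb t R δ = p.eval (t : ℝ)) →
        ∀ z ∈ Metric.ball ((t₀ : ℝ) : ℂ) r, ‖(p.map (algebraMap ℝ ℂ)).eval z‖ ≤ C) →
    ∀ t₀ : unitInterval, ∃ r > 0, ∀ R : ConformalRectangle, ∃ C : ℝ, ∀ δ : ℝ, 0 < δ →
      ∀ p : Polynomial ℝ,
        (∀ t : unitInterval, Percolation.cornerCrossingProb t R δ = p.eval (t : ℝ)) →
        ∀ z ∈ Metric.ball ((t₀ : ℝ) : ℂ) r, ‖(p.map (algebraMap ℝ ℂ)).eval z‖ ≤ C := by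
  intro hsmall t₀
  obtain ⟨r, hr, hR⟩ := hsmall t₀
  refine ⟨r, hr, fun R => ?_⟩
  obtain ⟨δ₁, hδ₁, C, hC⟩ := hR R
  -- the carrier is bounded: inside a closed ball `B̄(0, M)`
  obtain ⟨M, hM⟩ := (Metric.isBounded_iff_subset_closedBall (0 : ℂ)).1 R.isBounded
  -- the vertices drawn at any mesh `δ ≥ δ₁` all lie in the finite set `U = hfin.toFinset`
  have hfin := finite_drawn (Ω := Metric.closedBall (0 : ℂ) M) Metric.isBounded_closedBall hδ₁
  refine ⟨max C ((2 * (3 + r)) ^ (hfin.toFinset ×ˢ (Finset.univ : Finset (Fin 2))).card),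
    fun δ hδ p hp z hz => ?_⟩
  rcases lt_or_ge δ δ₁ with hlt | hle
  · -- small mesh: the hypothesis
    exact (hC δ hδ hlt p hp z hz).trans (le_max_left _ _)
  · -- large mesh: a cylinder polynomial over the fixed coordinate set `U × {0, 1}`
    have hsub : {y : Site 2 | (δ : ℂ) * squareLatticeEmbedding.z y ∈ R.carrier} ⊆
        ↑hfin.toFinset := by
      rw [Set.Finite.coe_toFinset]
      exact drawn_subset_of_le hM hδ₁ hle
    have hK := determinedBy_coinEvent_of_subset R δ hsub
    obtain ⟨q, hq, hqz⟩ := exists_cylinderPolynomial R δ hK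
    -- `p` IS the cylinder polynomial `q`: they agree on the infinite set `[0, 1]`
    have hpq : p = q := by
      refine Polynomial.eq_of_infinite_eval_eq p q ((Set.Icc_infinite zero_lt_one).mono ?_)
      intro x hx
      have h1 : cornerCrossingProb ⟨x, hx⟩ R δ = p.eval x := hp ⟨x, hx⟩
      have h2 : cornerCrossingProb ⟨x, hx⟩ R δ = q.eval x := hq ⟨x, hx⟩
      rw [h1] at h2
      exact h2
    -- `|z| ≤ 1 + r` on the disc
    have hz1 : ‖z‖ ≤ 1 + r := by
      rw [Metric.mem_ball, dist_eq_norm] at hz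
      have ht₀ : ‖((t₀ : ℝ) : ℂ)‖ ≤ 1 := by
        rw [Complex.norm_of_nonneg (unitInterval.nonneg t₀)]
        exact unitInterval.le_one t₀
      calc ‖z‖ = ‖(z - ((t₀ : ℝ) : ℂ)) + ((t₀ : ℝ) : ℂ)‖ := by rw [sub_add_cancel]
        _ ≤ ‖z - ((t₀ : ℝ) : ℂ)‖ + ‖((t₀ : ℝ) : ℂ)‖ := norm_add_le _ _
        _ ≤ 1 + r := by linarith
    rw [hpq]
    exact (hqz z).trans ((pow_le_pow_left₀ (by positivity) (by linarith) _).trans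
      (le_max_right _ _))

end Summit.CriticalPhenomena.CardyFormulaZ2.Theorems
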